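import Summits.BirchSwinnertonDyer.BirchSwinnertonDyer.Theorems.ClassRecordThreeEulerHalvesAtThreeEichlerShimuraTorsionCountH
import Summits.BirchSwinnertonDyer.BirchSwinnertonDyer.Theorems.ClassRecordThreeEulerHalvesAtThreeEichlerShimuraModLift
import HarnessLib

/-!
# The torsion-refined Shapiro count over a field `K`, part I: MOD-`n` LIFTING of parabolic cochains at level `Γ`

Helper file (route `ClassRecordThree`, crux `EulerHalvesAtThree`, print residue (SIGᶜ-lift)(ii); seat bsd-idea-10 g24, `--supports
stmt-BirchSwinnertonDyer-19109 --as helper`). The LEVEL FORM of the named fact `Literature.NumberTheory.Automorphic.parabolicCochain_modLift`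
is a THEOREM: for every finite-index level `Γ ≤ SL(2, ℤ)` with `-1 ∈ Γ` and every `n ≠ 0`,

  `modLift_level`: every additive `ψ : Γ → ℤ/nℤ` killing the parabolic and the finite-order elements is the reduction of an INTEGRAL additive
  parabolic-null `u : Γ → ℤ`.

Assembly: the integral parabolic-null additive maps form a lattice with a `ℤ`-basis `e₁, …, e_r` (`exists_integral_basis`: restriction to a finite
generating set embeds it into `ℤ^N`, `Submodule.basisOfPid`); the lifting engine `…EichlerShimuraModLift.modLift_of_basis` + CRT/induction
`modLift_of_prime` reduce everything to the rank bound `rankBound_level` (part H) at each prime `p` — including `p = 2, 3`, where the torsion-refined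
count of parts A–D is what works. Also: the lattice has rank EXACTLY `2g(X_Γ)` (`six_mul_rank_add_eq`). What remains for the quaternionic packaging
(SIGᶜ-lift)(ii)-split is only the transport `ι(O¹) ≅ Γ` (dossier `Cruxes/EulerHalvesAtThree/Lines/es-surj-gamma-transfer.md` §6–7). No named facts;
nothing specific to BSD; no summit statement is proved.

## References
* G. Shimura, *Introduction to the arithmetic theory of automorphic functions* (1971), §8.1 (8.1.4)–(8.1.6), §8.2 [ShimuraIATAF1971].
* H. Iwaniec, *Spectral methods of automorphic forms* (2002), Ch. 2 Prop. 2.6 [Iwaniec2002].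
-/

noncomputable section

open scoped MatrixGroups ModularForm

open CongruenceSubgroup Matrix.SpecialLinearGroup ModularGroup

set_option linter.dupNamespace false

namespace Summit.BirchSwinnertonDyer.BirchSwinnertonDyer.Theorems.EichlerShimuraLevelK

open _root_.Module _root_.LinearMap
open Literature.NumberTheory.EllipticCurves.ModularForms
open scoped Classical

variable {Γ : Subgroup SL(2, ℤ)}

/-! ### The lattice of integral additive `P`-null maps on a finitely generated group has a `ℤ`-basis -/

/-- The integral additive `P`-null maps `G → ℤ` as a `ℤ`-submodule of `G → ℤ`. [folklore] -/
def intLattice {G : Type*} [Group G] (P : G → Prop) : Submodule ℤ (G → ℤ) where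
  carrier := {u | (∀ γ δ : G, u (γ * δ) = u γ + u δ) ∧ ∀ γ : G, P γ → u γ = 0}
  add_mem' := fun {a b} ha hb ↦
    ⟨fun γ δ ↦ by simp only [Pi.add_apply]; rw [ha.1, hb.1]; ring, fun γ hγ ↦ by
      simp only [Pi.add_apply]; rw [ha.2 γ hγ, hb.2 γ hγ, add_zero]⟩
  zero_mem' := ⟨fun _ _ ↦ by simp, fun _ _ ↦ rfl⟩
  smul_mem' := fun c a ha ↦
    ⟨fun γ δ ↦ by simp only [Pi.smul_apply, smul_eq_mul]; rw [ha.1]; ring, fun γ hγ ↦ by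
      simp only [Pi.smul_apply, smul_eq_mul]; rw [ha.2 γ hγ, mul_zero]⟩

/-- Membership in `intLattice P`. [folklore] -/
@[simp] theorem mem_intLattice_iff {G : Type*} [Group G] {P : G → Prop} {u : G → ℤ} :
    u ∈ intLattice P ↔ (∀ γ δ : G, u (γ * δ) = u γ + u δ) ∧ ∀ γ : G, P γ → u γ = 0 := Iff.rfl

/-- Additive maps agreeing on a generating set agree. [folklore] -/
theorem additive_ext_of_closure {G : Type*} [Group G] {S₀ : Set G} (hS₀ : Subgroup.closure S₀ = ⊤) {u u' : G → ℤ}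
    (hu : ∀ γ δ : G, u (γ * δ) = u γ + u δ) (hu' : ∀ γ δ : G, u' (γ * δ) = u' γ + u' δ) (h : ∀ s ∈ S₀, u s = u' s) : u = u' := by
  funext γ
  have hγ : γ ∈ Subgroup.closure S₀ := by rw [hS₀]; exact Subgroup.mem_top γ
  induction hγ using Subgroup.closure_induction with
  | mem s hs => exact h s hs
  | one => rw [EichlerShimuraModLift.additive_map_one hu, EichlerShimuraModLift.additive_map_one hu']
  | mul x y _ _ hx hy => rw [hu, hu', hx, hy]
  | inv x _ hx =>
    have h₁ := hu x⁻¹ x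
    have h₂ := hu' x⁻¹ x
    rw [inv_mul_cancel, EichlerShimuraModLift.additive_map_one hu] at h₁
    rw [inv_mul_cancel, EichlerShimuraModLift.additive_map_one hu'] at h₂
    omega

/-- Coordinates in `intLattice P`: `↑(∑ cᵢ • bᵢ) = (γ ↦ ∑ cᵢ bᵢ(γ))`. [folklore] -/
theorem coe_sum_smul_intLattice {G : Type*} [Group G] {P : G → Prop} {n : ℕ} (b : Fin n → intLattice P) (c : Fin n → ℤ) :
    ((∑ i, c i • b i : intLattice P) : G → ℤ) = fun γ ↦ ∑ i, c i * (b i : G → ℤ) γ := by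
  funext γ
  rw [Submodule.coe_sum, Finset.sum_apply]
  exact Finset.sum_congr rfl fun i _ ↦ by rw [Submodule.coe_smul, Pi.smul_apply, smul_eq_mul]

/-- **An integral basis exists**: on a finitely generated group `G`, the lattice of additive `P`-null maps `G → ℤ` has a `ℤ`-basis `e₁, …, e_r` —
every additive `P`-null `u` has UNIQUE integral coordinates (restriction to a finite generating set embeds the lattice into `ℤ^N`; submodules of
`ℤ^N` are free, `Submodule.basisOfPid`). This is clause (i) of the signature clause, for any group and predicate. [folklore] -/
theorem exists_integral_basis {G : Type*} [Group G] [hG : Group.FG G] (P : G → Prop) :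
    ∃ (r : ℕ) (e : Fin r → G → ℤ), (∀ i, (∀ γ δ : G, e i (γ * δ) = e i γ + e i δ) ∧ ∀ γ : G, P γ → e i γ = 0) ∧
      ∀ u : G → ℤ, (∀ γ δ : G, u (γ * δ) = u γ + u δ) → (∀ γ : G, P γ → u γ = 0) →
        ∃! c : Fin r → ℤ, u = fun γ ↦ ∑ i, c i * e i γ := by
  obtain ⟨S₀, hS₀⟩ := hG.out
  -- restriction to the generators, injective on the lattice
  let ev : (G → ℤ) →ₗ[ℤ] (S₀ → ℤ) :=
    { toFun := fun u s ↦ u s, map_add' := fun _ _ ↦ rfl, map_smul' := fun _ _ ↦ rfl }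
  let f : intLattice P →ₗ[ℤ] (S₀ → ℤ) := ev.domRestrict (intLattice P)
  have hf : Function.Injective f := by
    rintro ⟨a, ha⟩ ⟨b, hb⟩ h
    refine Subtype.ext (additive_ext_of_closure hS₀ ha.1 hb.1 fun s hs ↦ ?_)
    exact congr_fun h ⟨s, hs⟩
  let eL : intLattice P ≃ₗ[ℤ] LinearMap.range f := LinearEquiv.ofInjective f hf
  obtain ⟨n, b'⟩ := Submodule.basisOfPid (Pi.basisFun ℤ S₀) (LinearMap.range f)
  let b : Basis (Fin n) ℤ (intLattice P) := b'.map eL.symm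
  refine ⟨n, fun i ↦ (b i : G → ℤ), fun i ↦ (b i).2, fun u hu hP ↦ ?_⟩
  refine ⟨b.equivFun ⟨u, hu, hP⟩, ?_, fun c hc ↦ ?_⟩
  · have h := congrArg (fun x : intLattice P ↦ (x : G → ℤ)) (b.sum_equivFun ⟨u, hu, hP⟩)
    simp only at h
    rw [coe_sum_smul_intLattice] at h
    exact h.symm
  · have h1 : (⟨u, hu, hP⟩ : intLattice P) = ∑ i, c i • b i := Subtype.ext (by rw [coe_sum_smul_intLattice]; exact hc)
    rw [h1]
    have h2 := b.equivFun.apply_symm_apply c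
    rw [Basis.equivFun_symm_apply] at h2
    exact h2.symm

/-! ### The rank of the integral parabolic lattice is exactly `2g` -/

/-- **An integral basis is `ℚ`-linearly independent** in `H¹_{par,tors}(Γ, ℚ)` (clear denominators in a rational relation and use uniqueness of the
integral coordinates of `0`); hence `r ≤ dim_ℚ H¹_{par,tors}(Γ, ℚ)`. [folklore] -/
theorem le_finrank_parTorsCocycles_rat [Γ.FiniteIndex] {r : ℕ} (e : Fin r → Γ → ℤ)
    (he : ∀ i, (∀ γ δ : Γ, e i (γ * δ) = e i γ + e i δ) ∧ ∀ γ : Γ, ((γ : SL(2, ℤ)) : Matrix (Fin 2) (Fin 2) ℤ).IsParabolic → e i γ = 0)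
    (huniq : ∀ u : Γ → ℤ, (∀ γ δ : Γ, u (γ * δ) = u γ + u δ) →
      (∀ γ : Γ, ((γ : SL(2, ℤ)) : Matrix (Fin 2) (Fin 2) ℤ).IsParabolic → u γ = 0) →
      ∃! c : Fin r → ℤ, u = fun γ ↦ ∑ i, c i * e i γ) :
    r ≤ finrank ℚ (parTorsCocycles ℚ Γ) := by
  haveI := finite_parTorsCocycles ℚ Γ
  let w : Fin r → parTorsCocycles ℚ Γ := fun i ↦ ⟨fun γ ↦ (e i γ : ℚ),
    mem_parTorsCocycles_of_charZero (fun γ δ ↦ by rw [(he i).1, Int.cast_add]) fun γ hγ ↦ by rw [(he i).2 γ hγ, Int.cast_zero]⟩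
  have hw : LinearIndependent ℚ w := by
    rw [Fintype.linearIndependent_iff]
    intro g hg
    -- clear denominators: `m i = D · g i` with `D = ∏ den`
    set m : Fin r → ℤ := fun i ↦ (∏ j ∈ Finset.univ.erase i, ((g j).den : ℤ)) * (g i).num with hm
    have hD : ∀ i, (m i : ℚ) = (∏ j, ((g j).den : ℚ)) * g i := fun i ↦ by
      rw [hm, ← Finset.mul_prod_erase Finset.univ _ (Finset.mem_univ i)]
      push_cast
      rw [mul_comm ((g i).den : ℚ), mul_assoc, Rat.den_mul_eq_num]
    have hD0 : (∏ j, ((g j).den : ℚ)) ≠ 0 := Finset.prod_ne_zero_iff.mpr fun j _ ↦ by exact_mod_cast (g j).den_nz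
    -- the integral relation `∑ mᵢ eᵢ = 0`
    have hrel : (fun γ : Γ ↦ ∑ i, m i * e i γ) = fun γ ↦ ∑ i, (0 : Fin r → ℤ) i * e i γ := by
      funext γ
      have hγ := congrArg (fun x : parTorsCocycles ℚ Γ ↦ (x : Γ → ℚ) γ) hg
      simp only [Submodule.coe_sum, Submodule.coe_smul, Finset.sum_apply, Pi.smul_apply, smul_eq_mul,
        Submodule.coe_zero, Pi.zero_apply] at hγ
      have h : ((∑ i, m i * e i γ : ℤ) : ℚ) = (∏ j, ((g j).den : ℚ)) * ∑ i, g i * (e i γ : ℚ) := by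
        push_cast
        rw [Finset.mul_sum]
        exact Finset.sum_congr rfl fun i _ ↦ by rw [hD i, mul_assoc]
      rw [hγ, mul_zero] at h
      simp only [Pi.zero_apply, zero_mul, Finset.sum_const_zero]
      exact_mod_cast h
    obtain ⟨c, -, hc⟩ := huniq (fun _ ↦ 0) (fun _ _ ↦ by simp) (fun _ _ ↦ rfl)
    have h0 : (fun γ : Γ ↦ (0 : ℤ)) = fun γ ↦ ∑ i, (0 : Fin r → ℤ) i * e i γ := by funext γ; simp
    have hmc : m = c := hc m (h0.trans hrel.symm)
    have h0c : (0 : Fin r → ℤ) = c := hc 0 h0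
    intro i
    have hmi : m i = 0 := by rw [hmc, ← h0c]; rfl
    have h := hD i
    rw [hmi, Int.cast_zero] at h
    exact (mul_eq_zero.mp h.symm).resolve_left hD0
  simpa using hw.fintype_card_le_finrank

/-- **The integral parabolic lattice of a finite-index `Γ ∋ -1` has rank exactly `2g(X_Γ)`**: for ANY integral basis `e₁, …, e_r` (unique
coordinates), `6r + 3ν₂ + 4ν₃ + 6ε_∞ = 12 + [SL(2, ℤ) : Γ]`. [cite: ShimuraIATAF1971, §8.2 (8.2.24) with Prop. 1.40] -/
theorem six_mul_rank_add_eq [Γ.FiniteIndex] (hneg : (-1 : SL(2, ℤ)) ∈ Γ) {r : ℕ} (e : Fin r → Γ → ℤ)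
    (he : ∀ i, (∀ γ δ : Γ, e i (γ * δ) = e i γ + e i δ) ∧ ∀ γ : Γ, ((γ : SL(2, ℤ)) : Matrix (Fin 2) (Fin 2) ℤ).IsParabolic → e i γ = 0)
    (huniq : ∀ u : Γ → ℤ, (∀ γ δ : Γ, u (γ * δ) = u γ + u δ) →
      (∀ γ : Γ, ((γ : SL(2, ℤ)) : Matrix (Fin 2) (Fin 2) ℤ).IsParabolic → u γ = 0) →
      ∃! c : Fin r → ℤ, u = fun γ ↦ ∑ i, c i * e i γ) :
    6 * r + 3 * Level.nu₂Level Γ + 4 * Level.nu₃Level Γ + 6 * (Level.basePoints Γ).card = 12 + Γ.index := by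
  have h₁ := le_finrank_parTorsCocycles_rat e he huniq
  have h₂ := finrank_parTorsCocycles_rat_le e huniq
  have h₃ := six_mul_finrank_parTorsCocycles_eq (K := ℚ) (Γ := Γ) hneg
  omega

/-! ### Mod-`n` lifting at level `Γ` -/

/-- **Mod-`p` lifting at level `Γ`** (`p` prime): every additive `ψ : Γ → 𝔽_p` killing the parabolic and the finite-order elements of a finite-index
`Γ ∋ -1` is the reduction of an integral additive parabolic-null `u : Γ → ℤ` (integral basis + `rankBound_level` + the lifting engine
`EichlerShimuraModLift.modLift_of_basis`). [cite: ShimuraIATAF1971, §8.1 (8.1.4)–(8.1.6), §8.2 (8.2.6), (8.2.24)] -/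
theorem modLift_level_prime [Γ.FiniteIndex] (hneg : (-1 : SL(2, ℤ)) ∈ Γ) {p : ℕ} [Fact p.Prime] (ψ : Γ → ZMod p)
    (hadd : ∀ γ δ : Γ, ψ (γ * δ) = ψ γ + ψ δ) (htors : ∀ γ : Γ, IsOfFinOrder γ → ψ γ = 0)
    (hpar : ∀ γ : Γ, ((γ : SL(2, ℤ)) : Matrix (Fin 2) (Fin 2) ℤ).IsParabolic → ψ γ = 0) :
    ∃ u : Γ → ℤ, (∀ γ δ : Γ, u (γ * δ) = u γ + u δ) ∧
      (∀ γ : Γ, ((γ : SL(2, ℤ)) : Matrix (Fin 2) (Fin 2) ℤ).IsParabolic → u γ = 0) ∧ ∀ γ : Γ, (u γ : ZMod p) = ψ γ := by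
  haveI := fg_level (Γ := Γ)
  obtain ⟨r, e, he, huniq⟩ := exists_integral_basis (fun γ : Γ ↦ ((γ : SL(2, ℤ)) : Matrix (Fin 2) (Fin 2) ℤ).IsParabolic)
  exact EichlerShimuraModLift.modLift_of_basis _ e he huniq (fun s v hv hli ↦ rankBound_level hneg e huniq v hv hli) ψ hadd htors hpar

/-- **Mod-`n` lifting at level `Γ` — the level form of `Literature.NumberTheory.Automorphic.parabolicCochain_modLift` is a THEOREM**: for every
finite-index `Γ ≤ SL(2, ℤ)` with `-1 ∈ Γ` and every `n ≠ 0`, every additive `ψ : Γ → ℤ/nℤ` killing the parabolic and the finite-order elements is the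
reduction of an integral additive parabolic-null `u : Γ → ℤ` (primes by `modLift_level_prime`, then CRT/induction `EichlerShimuraModLift.modLift_of_prime`).
[cite: ShimuraIATAF1971, §8.1–8.2] -/
theorem modLift_level [Γ.FiniteIndex] (hneg : (-1 : SL(2, ℤ)) ∈ Γ) (n : ℕ) (hn : n ≠ 0) (ψ : Γ → ZMod n)
    (hadd : ∀ γ δ : Γ, ψ (γ * δ) = ψ γ + ψ δ) (htors : ∀ γ : Γ, IsOfFinOrder γ → ψ γ = 0)
    (hpar : ∀ γ : Γ, ((γ : SL(2, ℤ)) : Matrix (Fin 2) (Fin 2) ℤ).IsParabolic → ψ γ = 0) :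
    ∃ u : Γ → ℤ, (∀ γ δ : Γ, u (γ * δ) = u γ + u δ) ∧
      (∀ γ : Γ, ((γ : SL(2, ℤ)) : Matrix (Fin 2) (Fin 2) ℤ).IsParabolic → u γ = 0) ∧ ∀ γ : Γ, (u γ : ZMod n) = ψ γ := by
  refine EichlerShimuraModLift.modLift_of_prime (fun γ : Γ ↦ ((γ : SL(2, ℤ)) : Matrix (Fin 2) (Fin 2) ℤ).IsParabolic) ?_ n hn ψ hadd
    htors hpar
  intro p hp φ h₁ h₂ h₃
  haveI : Fact p.Prime := ⟨hp⟩
  exact modLift_level_prime hneg φ h₁ h₂ h₃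

end Summit.BirchSwinnertonDyer.BirchSwinnertonDyer.Theorems.EichlerShimuraLevelK

end
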